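import Summits.QuantumFields.YangMills.Theorems.BalabanUVNodesN15KingModelExactLineIntegral
import Summits.QuantumFields.YangMills.Theorems.BalabanUVNodesN15KingModelCorrelationLength

/-!
# BalabanUVNodes ∕ N15 — THE KING-MODEL RUNG (PART Ϸ-j): THE LAPLACE REPRESENTATION OF `S₂^{ℝ}` IN A LATTICE DIRECTION, STRICT POSITIVITY ON THE AXES, AND THE
# EXACT CORRELATION LENGTH `lim_t |S₂^{ℝ}(te_ν)|^{1∕t} = e^{−m}` (Track A, DAG node N15 = NE2; FAN-OUT v1.1 §N15 s3 «KING-MODEL RUNG»; closes part Ϸ-e's `≤` to `=`;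
# count-neutral)

HONEST FRAMING.  Count-neutral (cell `pub-ymgap`, seat `pub-ymgap-dag-n15-e` g34; `--supports stmt-QuantumFields-27366 --as helper` = K3⁸
`SpineGivenEndpointR13SepCoPHV`).  King's `A = 0`, `g = 0` model ([King1986] C. King, Commun. Math. Phys. **102** (1986) 649–677): the continuum (`K = ∞`,
infinite-volume) two-point function `S₂^{ℝ}(z) = (2π)^{−(d+1)}∫Π_μ sinc²(p_μ∕2)cos(p·z)∕(p²+m²)dp` of the unit-block averages of the free field ((4.5) p.670, (4.36)
p.674; Thm 3.3 (3.6) p.655 is its exponential clustering).  Part Ϸ-i computed the `p_ν`-integral exactly; integrating the remaining `p_⊥ ∈ ℝ^d` (Fubini, as in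
part Ϸ-c) gives, for `|z_ν| ≥ 1`, the LAPLACE-TYPE REPRESENTATION
`S₂^{ℝ}(z) = (2π)^{−(d+1)}∫_{ℝ^d} P(q)cos(q·z_⊥)·2π(cosh M_q − 1)M_q⁻³·e^{−M_q|z_ν|}dq`, `M_q = √(|q|²+m²) ≥ m`, `P(q) = Π_j sinc²(q_j∕2) ≥ 0` — a superposition of
decaying exponentials `e^{−M|z_ν|}`, `M ≥ m`, with a weight that is POSITIVE on the axis (`z_⊥ = 0`).  Consequences: (a) `S₂^{ℝ}(te_ν) > 0` for every integer
`|t| ≥ 1` (strict positivity of the axial two-point function); (b) the lower bound `S₂^{ℝ}(te_ν) ≥ K_δ e^{−√(m²+dδ²)|t|}` for every `0 < δ ≤ 1` (restrict `q` to the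
cube `[−δ,δ]^d`, where `P ≥ 2^{−d}`); (c) with part Ϸ-e's `limsup ≤ e^{−m}`: the LIMIT EXISTS and `lim_{t→∞}|S₂^{ℝ}(te_ν)|^{1∕t} = e^{−m}` — the correlation length
of King's free block field is EXACTLY `1∕m` in every lattice direction (no blocking artefact in the rate; the block form factor only enters the prefactor).  NOT a
node discharge (N15 is booked through n15-a's knit, untouched here); nothing Bałaban ∕ continuum-Yang–Mills ∕ `ℝ⁴` ∕ OS ∕ Clay; the «mass» is the free field's
`m`.  0 `sorry`, 0 def; standard axioms.

WHAT THIS FILE PROVES (kernel).  §1 ★★★ **`kingS2Inf_eq_integral_exp`** (the Laplace representation, `|z_ν| ≥ 1`), ★★ `kingS2Inf_single_eq` (on the axis).  §2 the axial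
weight: `axisWeight_nonneg`, `continuous_axisWeight`, `axisWeight_le_window`, ★ `integrable_axisWeight`, `axisWeight_zero_pos`, ★★★ **`kingS2Inf_single_pos`**
(`S₂^{ℝ}(te_ν) > 0`, `|t| ≥ 1`).  §3 the cube bound: `half_le_sinc_sq` (`sinc²y ≥ 1∕2` for `|y| ≤ 1∕2`), `axisWeight_ge_on_cube`, ★★ **`kingS2Inf_single_ge`**
(`S₂^{ℝ}(te_ν) ≥ (2π)^{−(d+1)}(2δ)^d 2^{−d}·2π(cosh m − 1)∕M_δ³·e^{−M_δ|t|}`, `M_δ = √(dδ²+m²)`).  §4 ★★ `liminf_rpow_abs_kingS2Inf_axis_ge` (`≥ e^{−M_δ}`, every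
`0 < δ ≤ 1`), ★★ `le_liminf_rpow_abs_kingS2Inf_axis` (`≥ e^{−m}`), ★★★ **`tendsto_rpow_abs_kingS2Inf_axis`** (`|S₂^{ℝ}(te_ν)|^{1∕t} → e^{−√m²}`).

HONEST SCOPE.  King's free model, `K = ∞`, infinite volume, lattice axes (`z_⊥ = 0`; off the axes the phase `cos(q·z_⊥)` is signed and only part Ϸ-c∕e's upper
bounds are claimed).  N15 untouched; counts unmoved.  Locators (use): [King1986] (4.5) p.670, (4.36) p.674, Thm 3.3 (3.6) p.655, Thm 2.1 (2.22) p.654;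
[ButzerNessel1971] (12.4.3), Problem 5.1.2 (via part Ϸ-i).
-/

noncomputable section

open scoped BigOperators Topology
open Filter MeasureTheory Set

namespace Summit.QuantumFields.YangMills.BalabanUVNodes.N15KingModelRung.OptimalDecay

variable {d : ℕ}

/-! ## §1 The Laplace representation in the direction `ν` -/

/-- ★★★ **THE LAPLACE REPRESENTATION OF `S₂^{ℝ}` IN THE DIRECTION `ν`**: for `|z_ν| ≥ 1`,
`S₂^{ℝ}(z) = (2π)^{−(d+1)}∫_{ℝ^d}P(q)·cos(Σ_j q_j z_{ν↑j})·2π(cosh M_q − 1)M_q⁻³e^{−M_q|z_ν|}dq`, `M_q = √(|q|²+m²)`, `P(q) = Π_j sinc²(q_j∕2)` (Fubini over `p_⊥`, part Ϸ-i on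
each `p_ν`-line). [cite: King1986, (4.5) p.670, (4.36) p.674, Thm 3.3 (3.6) p.655] -/
theorem kingS2Inf_eq_integral_exp {m2 : ℝ} (hm : 0 < m2) (z : Fin (d + 1) → ℤ) (ν : Fin (d + 1)) (hz : 1 ≤ |(z ν : ℝ)|) :
    kingS2Inf m2 z = ((2 * Real.pi) ^ (d + 1))⁻¹ * ∫ q : Fin d → ℝ, (∏ j, Real.sinc (q j / 2) ^ 2) * (Real.cos (∑ j, q j * z (ν.succAbove j))
          * (2 * Real.pi * (Real.cosh (Real.sqrt ((∑ j, q j ^ 2) + m2)) - 1) / Real.sqrt ((∑ j, q j ^ 2) + m2) ^ 3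
              * Real.exp (-(Real.sqrt ((∑ j, q j ^ 2) + m2) * |(z ν : ℝ)|)))) := by
  set e := MeasurableEquiv.piFinSuccAbove (fun _ : Fin (d + 1) => ℝ) ν with he
  have hemp : MeasurePreserving e volume volume := volume_preserving_piFinSuccAbove (fun _ : Fin (d + 1) => ℝ) ν
  have hsymm : MeasurePreserving e.symm volume volume := hemp.symm e
  set F : (Fin (d + 1) → ℝ) → ℝ := twoPtIntegrand m2 z with hF
  have hFint : Integrable F := integrable_twoPtIntegrand hm z
  have h1 : ∫ p, F p = ∫ y : ℝ × (Fin d → ℝ), F (e.symm y) := (hsymm.integral_comp' F).symm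
  have hGint : Integrable (fun y : ℝ × (Fin d → ℝ) => F (e.symm y)) := (hsymm.integrable_comp_emb e.symm.measurableEmbedding).mpr hFint
  have hsymm_apply : ∀ (x : ℝ) (q : Fin d → ℝ), e.symm (x, q) = Fin.insertNth ν x q := fun x q => by
    rw [he, MeasurableEquiv.piFinSuccAbove_symm_apply]
    rfl
  have h2 : ∫ y : ℝ × (Fin d → ℝ), F (e.symm y) = ∫ q : Fin d → ℝ, ∫ x : ℝ, F (e.symm (x, q)) := by
    rw [Measure.volume_eq_prod] at hGint ⊢
    exact integral_prod_symm _ hGint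
  unfold kingS2Inf
  rw [← hF, h1, h2]
  congr 1
  refine integral_congr_ae (Eventually.of_forall fun q => ?_)
  simp_rw [hsymm_apply]
  exact integral_twoPtIntegrand_insertNth_eq hm z ν hz q

/-- ★★ **On the axis** `z = te_ν` (`|t| ≥ 1`): the phase is `cos 0 = 1` and
`S₂^{ℝ}(te_ν) = (2π)^{−(d+1)}∫P(q)·2π(cosh M_q − 1)M_q⁻³e^{−M_q|t|}dq`. [cite: King1986, (4.5) p.670, Thm 3.3 (3.6) p.655] -/
theorem kingS2Inf_single_eq {m2 : ℝ} (hm : 0 < m2) (ν : Fin (d + 1)) {t : ℤ} (ht : 1 ≤ |(t : ℝ)|) :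
    kingS2Inf m2 (Pi.single ν t) = ((2 * Real.pi) ^ (d + 1))⁻¹ * ∫ q : Fin d → ℝ, (∏ j, Real.sinc (q j / 2) ^ 2)
          * (2 * Real.pi * (Real.cosh (Real.sqrt ((∑ j, q j ^ 2) + m2)) - 1) / Real.sqrt ((∑ j, q j ^ 2) + m2) ^ 3
              * Real.exp (-(Real.sqrt ((∑ j, q j ^ 2) + m2) * |(t : ℝ)|))) := by
  have hz : 1 ≤ |(((Pi.single ν t : Fin (d + 1) → ℤ) ν : ℤ) : ℝ)| := by simpa using ht
  rw [kingS2Inf_eq_integral_exp hm _ ν hz]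
  congr 1
  refine integral_congr_ae (Eventually.of_forall fun q => ?_)
  have h0 : ∀ j : Fin d, (Pi.single ν t : Fin (d + 1) → ℤ) (ν.succAbove j) = 0 := fun j => Pi.single_eq_of_ne (Fin.succAbove_ne ν j) _
  simp only [h0, Pi.single_eq_same, Int.cast_zero, mul_zero, Finset.sum_const_zero, Real.cos_zero, one_mul]

/-! ## §2 The axial weight: nonnegativity, integrability, strict positivity -/

/-- The axial weight is nonnegative: `P(q)·2π(cosh M_q − 1)M_q⁻³e^{−M_q|t|} ≥ 0`. [folklore] -/
theorem axisWeight_nonneg (m2 t : ℝ) (q : Fin d → ℝ) :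
    0 ≤ (∏ j, Real.sinc (q j / 2) ^ 2) * (2 * Real.pi * (Real.cosh (Real.sqrt ((∑ j, q j ^ 2) + m2)) - 1) / Real.sqrt ((∑ j, q j ^ 2) + m2) ^ 3
        * Real.exp (-(Real.sqrt ((∑ j, q j ^ 2) + m2) * |t|))) := by
  have h1 : 0 ≤ Real.cosh (Real.sqrt ((∑ j, q j ^ 2) + m2)) - 1 := by linarith [Real.one_le_cosh (Real.sqrt ((∑ j, q j ^ 2) + m2))]
  have hP : 0 ≤ ∏ j, Real.sinc (q j / 2) ^ 2 := Finset.prod_nonneg fun j _ => sq_nonneg _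
  positivity

/-- The axial weight is continuous in `q` (`m² > 0`). [folklore] -/
theorem continuous_axisWeight {m2 : ℝ} (hm : 0 < m2) (t : ℝ) :
    Continuous fun q : Fin d → ℝ => (∏ j, Real.sinc (q j / 2) ^ 2) * (2 * Real.pi * (Real.cosh (Real.sqrt ((∑ j, q j ^ 2) + m2)) - 1) / Real.sqrt ((∑ j, q j ^ 2) + m2) ^ 3
        * Real.exp (-(Real.sqrt ((∑ j, q j ^ 2) + m2) * |t|))) := by
  have hM : ∀ q : Fin d → ℝ, Real.sqrt ((∑ j, q j ^ 2) + m2) ^ 3 ≠ 0 := fun q => by positivity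
  refine Continuous.mul (by fun_prop) (Continuous.mul (Continuous.div (by fun_prop) (by fun_prop) hM) (by fun_prop))

/-- The axial weight under the window majorant (`|t| ≥ 1`): `≤ 2π∕√m²³·Π_j (17+16π²)(1+q_j²)⁻¹` (`(cosh M − 1)e^{−M|t|} ≤ e^{M}e^{−M} = 1`, `M ≥ √m²`). [folklore] -/
theorem axisWeight_le_window {m2 t : ℝ} (hm : 0 < m2) (ht : 1 ≤ |t|) (q : Fin d → ℝ) :
    (∏ j, Real.sinc (q j / 2) ^ 2) * (2 * Real.pi * (Real.cosh (Real.sqrt ((∑ j, q j ^ 2) + m2)) - 1) / Real.sqrt ((∑ j, q j ^ 2) + m2) ^ 3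
        * Real.exp (-(Real.sqrt ((∑ j, q j ^ 2) + m2) * |t|)))
      ≤ 2 * Real.pi / Real.sqrt m2 ^ 3 * ∏ j, ((17 + 16 * Real.pi ^ 2) * (1 + q j ^ 2)⁻¹) := by
  set M := Real.sqrt ((∑ j, q j ^ 2) + m2) with hMdef
  have hm' : 0 < Real.sqrt m2 := Real.sqrt_pos.mpr hm
  have hmM : Real.sqrt m2 ≤ M := Real.sqrt_le_sqrt (le_add_of_nonneg_left (Finset.sum_nonneg fun j _ => sq_nonneg _))
  have hM0 : 0 < M := hm'.trans_le hmM
  have hP : 0 ≤ ∏ j, Real.sinc (q j / 2) ^ 2 := Finset.prod_nonneg fun j _ => sq_nonneg _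
  have hPle : ∏ j, Real.sinc (q j / 2) ^ 2 ≤ ∏ j, ((17 + 16 * Real.pi ^ 2) * (1 + q j ^ 2)⁻¹) :=
    Finset.prod_le_prod (fun j _ => sq_nonneg _) fun j _ => sinc_sq_half_window (s := q j) (t := q j) (by simp; positivity)
  have h0 : 0 ≤ Real.cosh M - 1 := by linarith [Real.one_le_cosh M]
  -- `(cosh M − 1)e^{−M|t|} ≤ 1`
  have hce : (Real.cosh M - 1) * Real.exp (-(M * |t|)) ≤ 1 := by
    have h1 : Real.cosh M - 1 ≤ Real.exp M := by
      rw [Real.cosh_eq]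
      have : Real.exp (-M) ≤ Real.exp M := Real.exp_le_exp.mpr (by linarith)
      linarith [Real.exp_pos (-M)]
    have h2 : Real.exp (-(M * |t|)) ≤ Real.exp (-M) := Real.exp_le_exp.mpr (by nlinarith)
    calc (Real.cosh M - 1) * Real.exp (-(M * |t|)) ≤ Real.exp M * Real.exp (-M) := mul_le_mul h1 h2 (Real.exp_pos _).le (Real.exp_pos _).le
      _ = 1 := by rw [← Real.exp_add, add_neg_cancel, Real.exp_zero]
  have hw : 2 * Real.pi * (Real.cosh M - 1) / M ^ 3 * Real.exp (-(M * |t|)) ≤ 2 * Real.pi / Real.sqrt m2 ^ 3 := by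
    rw [show 2 * Real.pi * (Real.cosh M - 1) / M ^ 3 * Real.exp (-(M * |t|)) = 2 * Real.pi / M ^ 3 * ((Real.cosh M - 1) * Real.exp (-(M * |t|))) by ring]
    calc 2 * Real.pi / M ^ 3 * ((Real.cosh M - 1) * Real.exp (-(M * |t|))) ≤ 2 * Real.pi / M ^ 3 * 1 := mul_le_mul_of_nonneg_left hce (by positivity)
      _ ≤ 2 * Real.pi / Real.sqrt m2 ^ 3 := by
          rw [mul_one]
          exact div_le_div_of_nonneg_left (by positivity) (by positivity) (pow_le_pow_left₀ hm'.le hmM 3)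
  calc _ ≤ (∏ j, ((17 + 16 * Real.pi ^ 2) * (1 + q j ^ 2)⁻¹)) * (2 * Real.pi / Real.sqrt m2 ^ 3) :=
        mul_le_mul hPle hw (by positivity) (hP.trans hPle)
    _ = _ := mul_comm _ _

/-- ★ The axial weight is integrable over `ℝ^d` (`|t| ≥ 1`). [folklore] -/
theorem integrable_axisWeight {m2 t : ℝ} (hm : 0 < m2) (ht : 1 ≤ |t|) :
    Integrable fun q : Fin d → ℝ => (∏ j, Real.sinc (q j / 2) ^ 2) * (2 * Real.pi * (Real.cosh (Real.sqrt ((∑ j, q j ^ 2) + m2)) - 1) / Real.sqrt ((∑ j, q j ^ 2) + m2) ^ 3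
        * Real.exp (-(Real.sqrt ((∑ j, q j ^ 2) + m2) * |t|))) := by
  have hwin : Integrable (fun q : Fin d → ℝ => 2 * Real.pi / Real.sqrt m2 ^ 3 * ∏ j, ((17 + 16 * Real.pi ^ 2) * (1 + q j ^ 2)⁻¹)) :=
    (Integrable.fintype_prod (f := fun (_ : Fin d) (x : ℝ) => (17 + 16 * Real.pi ^ 2) * (1 + x ^ 2)⁻¹)
      fun _ => integrable_inv_one_add_sq.const_mul _).const_mul _
  refine hwin.mono' (continuous_axisWeight hm t).aestronglyMeasurable (Eventually.of_forall fun q => ?_)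
  rw [Real.norm_eq_abs, abs_of_nonneg (axisWeight_nonneg m2 t q)]
  exact axisWeight_le_window hm ht q

/-- The axial weight at `q = 0` is `2π(cosh m − 1)m⁻³e^{−m|t|} > 0` (`m = √m² > 0`). [folklore] -/
theorem axisWeight_zero_pos {m2 : ℝ} (hm : 0 < m2) (t : ℝ) :
    0 < (∏ j, Real.sinc ((0 : Fin d → ℝ) j / 2) ^ 2) * (2 * Real.pi * (Real.cosh (Real.sqrt ((∑ j, (0 : Fin d → ℝ) j ^ 2) + m2)) - 1)
        / Real.sqrt ((∑ j, (0 : Fin d → ℝ) j ^ 2) + m2) ^ 3 * Real.exp (-(Real.sqrt ((∑ j, (0 : Fin d → ℝ) j ^ 2) + m2) * |t|))) := by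
  have hm' : 0 < Real.sqrt m2 := Real.sqrt_pos.mpr hm
  have hc : 0 < Real.cosh (Real.sqrt m2) - 1 := by linarith [Real.one_lt_cosh.mpr hm'.ne']
  simp only [Pi.zero_apply, zero_div, Real.sinc_zero, one_pow, Finset.prod_const_one, one_mul, ne_eq, OfNat.ofNat_ne_zero, not_false_eq_true, zero_pow,
    Finset.sum_const_zero, zero_add]
  positivity

/-- ★★★ **STRICT POSITIVITY OF THE AXIAL TWO-POINT FUNCTION**: `S₂^{ℝ}(te_ν) > 0` for every integer `|t| ≥ 1` and every direction `ν` (the Laplace weight is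
nonnegative, continuous, and positive at `q = 0`). [cite: King1986, (4.5) p.670, Thm 3.3 (3.6) p.655] -/
theorem kingS2Inf_single_pos {m2 : ℝ} (hm : 0 < m2) (ν : Fin (d + 1)) {t : ℤ} (ht : 1 ≤ |(t : ℝ)|) : 0 < kingS2Inf m2 (Pi.single ν t) := by
  rw [kingS2Inf_single_eq hm ν ht]
  refine mul_pos (by positivity) ?_
  set W : (Fin d → ℝ) → ℝ := fun q => (∏ j, Real.sinc (q j / 2) ^ 2) * (2 * Real.pi * (Real.cosh (Real.sqrt ((∑ j, q j ^ 2) + m2)) - 1)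
      / Real.sqrt ((∑ j, q j ^ 2) + m2) ^ 3 * Real.exp (-(Real.sqrt ((∑ j, q j ^ 2) + m2) * |(t : ℝ)|))) with hW
  have hWnn : 0 ≤ W := fun q => axisWeight_nonneg m2 (t : ℝ) q
  have hWint : Integrable W := integrable_axisWeight hm ht
  rw [integral_pos_iff_support_of_nonneg hWnn hWint]
  -- the open set `{W > 0}` contains `0`
  have hopen : IsOpen {q : Fin d → ℝ | 0 < W q} := isOpen_lt continuous_const (continuous_axisWeight hm (t : ℝ))
  have h0 : (0 : Fin d → ℝ) ∈ {q : Fin d → ℝ | 0 < W q} := axisWeight_zero_pos hm (t : ℝ)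
  have hsub : {q : Fin d → ℝ | 0 < W q} ⊆ Function.support W := fun q hq => ne_of_gt hq
  exact (hopen.measure_pos volume ⟨0, h0⟩).trans_le (measure_mono hsub)

/-! ## §3 The cube lower bound -/

/-- `sinc²y ≥ 1∕2` for `|y| ≤ 1∕2` (`sin y > y − y³∕6`). [folklore] -/
theorem half_le_sinc_sq {y : ℝ} (hy : |y| ≤ 1 / 2) : 1 / 2 ≤ Real.sinc y ^ 2 := by
  -- reduce to `y ≥ 0`
  wlog hy0 : 0 ≤ y generalizing y
  · have h := this (y := -y) (by rwa [abs_neg]) (by linarith)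
    rwa [Real.sinc_neg] at h
  rcases hy0.eq_or_lt with rfl | hpos
  · simp
    norm_num
  rw [abs_of_nonneg hy0] at hy
  have hs : 23 / 24 ≤ Real.sinc y := by
    rw [Real.sinc_of_ne_zero hpos.ne', le_div_iff₀ hpos]
    have h3 := Real.sin_gt_sub_cube hpos
    have hy2 : y ^ 2 ≤ 1 / 4 := by nlinarith
    nlinarith [mul_le_mul_of_nonneg_left hy2 hy0]
  nlinarith

/-- On the cube `[−δ,δ]^d`, `0 < δ ≤ 1`: the axial weight is `≥ 2^{−d}·2π(cosh m − 1)∕M_δ³·e^{−M_δ|t|}`, `M_δ = √(dδ²+m²)`, `m = √m²`. [folklore] -/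
theorem axisWeight_ge_on_cube {m2 δ : ℝ} (hm : 0 < m2) (hδ : 0 < δ) (hδ1 : δ ≤ 1) (t : ℝ) {q : Fin d → ℝ}
    (hq : q ∈ Icc (fun _ => -δ) (fun _ => δ)) :
    (1 / 2 : ℝ) ^ d * (2 * Real.pi * (Real.cosh (Real.sqrt m2) - 1) / Real.sqrt (d * δ ^ 2 + m2) ^ 3 * Real.exp (-(Real.sqrt (d * δ ^ 2 + m2) * |t|)))
      ≤ (∏ j, Real.sinc (q j / 2) ^ 2) * (2 * Real.pi * (Real.cosh (Real.sqrt ((∑ j, q j ^ 2) + m2)) - 1) / Real.sqrt ((∑ j, q j ^ 2) + m2) ^ 3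
        * Real.exp (-(Real.sqrt ((∑ j, q j ^ 2) + m2) * |t|))) := by
  set M := Real.sqrt ((∑ j, q j ^ 2) + m2) with hMdef
  set Mδ := Real.sqrt (d * δ ^ 2 + m2) with hMδdef
  have hm' : 0 < Real.sqrt m2 := Real.sqrt_pos.mpr hm
  have hqj : ∀ j, |q j| ≤ δ := fun j => abs_le.mpr ⟨(mem_Icc.mp hq).1 j, (mem_Icc.mp hq).2 j⟩
  have hsum : (∑ j, q j ^ 2) ≤ d * δ ^ 2 := by
    calc (∑ j, q j ^ 2) ≤ ∑ _j : Fin d, δ ^ 2 := Finset.sum_le_sum fun j _ => by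
            rw [← sq_abs]
            exact pow_le_pow_left₀ (abs_nonneg _) (hqj j) 2
      _ = d * δ ^ 2 := by simp
  have hmM : Real.sqrt m2 ≤ M := Real.sqrt_le_sqrt (le_add_of_nonneg_left (Finset.sum_nonneg fun j _ => sq_nonneg _))
  have hM0 : 0 < M := hm'.trans_le hmM
  have hMMδ : M ≤ Mδ := Real.sqrt_le_sqrt (by linarith)
  have hMδ0 : 0 < Mδ := hM0.trans_le hMMδ
  -- `P(q) ≥ 2^{−d}`
  have hP : (1 / 2 : ℝ) ^ d ≤ ∏ j, Real.sinc (q j / 2) ^ 2 := by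
    calc (1 / 2 : ℝ) ^ d = ∏ _j : Fin d, (1 / 2 : ℝ) := by simp
      _ ≤ ∏ j, Real.sinc (q j / 2) ^ 2 := Finset.prod_le_prod (fun j _ => by norm_num) fun j _ => half_le_sinc_sq (by
            rw [abs_div, abs_two]
            linarith [hqj j])
  -- the weight: `cosh M − 1 ≥ cosh m − 1 > 0`, `M³ ≤ M_δ³`, `e^{−M|t|} ≥ e^{−M_δ|t|}`
  have hc0 : 0 < Real.cosh (Real.sqrt m2) - 1 := by linarith [Real.one_lt_cosh.mpr hm'.ne']
  have hcosh : Real.cosh (Real.sqrt m2) - 1 ≤ Real.cosh M - 1 := by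
    have := Real.cosh_le_cosh.mpr (show |Real.sqrt m2| ≤ |M| by rw [abs_of_pos hm', abs_of_pos hM0]; exact hmM)
    linarith
  have hcM : 0 ≤ Real.cosh M - 1 := hc0.le.trans hcosh
  have hw : 2 * Real.pi * (Real.cosh (Real.sqrt m2) - 1) / Mδ ^ 3 ≤ 2 * Real.pi * (Real.cosh M - 1) / M ^ 3 :=
    div_le_div₀ (by positivity) (by nlinarith [Real.pi_pos]) (by positivity) (pow_le_pow_left₀ hM0.le hMMδ 3)
  have he : Real.exp (-(Mδ * |t|)) ≤ Real.exp (-(M * |t|)) := Real.exp_le_exp.mpr (by nlinarith [abs_nonneg t])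
  have hw0 : 0 ≤ 2 * Real.pi * (Real.cosh (Real.sqrt m2) - 1) / Mδ ^ 3 := by positivity
  calc (1 / 2 : ℝ) ^ d * (2 * Real.pi * (Real.cosh (Real.sqrt m2) - 1) / Mδ ^ 3 * Real.exp (-(Mδ * |t|)))
      ≤ (∏ j, Real.sinc (q j / 2) ^ 2) * (2 * Real.pi * (Real.cosh M - 1) / M ^ 3 * Real.exp (-(M * |t|))) :=
        mul_le_mul hP (mul_le_mul hw he (Real.exp_pos _).le (hw0.trans hw)) (by positivity) (Finset.prod_nonneg fun j _ => sq_nonneg _)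

/-- ★★ **THE CUBE LOWER BOUND**: for `|t| ≥ 1` and `0 < δ ≤ 1`, `S₂^{ℝ}(te_ν) ≥ (2π)^{−(d+1)}·(2δ)^d·2^{−d}·2π(cosh m − 1)∕M_δ³·e^{−M_δ|t|}`, `M_δ = √(dδ²+m²)`.
[cite: King1986, (4.5) p.670, Thm 3.3 (3.6) p.655] -/
theorem kingS2Inf_single_ge {m2 δ : ℝ} (hm : 0 < m2) (hδ : 0 < δ) (hδ1 : δ ≤ 1) (ν : Fin (d + 1)) {t : ℤ} (ht : 1 ≤ |(t : ℝ)|) :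
    ((2 * Real.pi) ^ (d + 1))⁻¹ * ((2 * δ) ^ d * ((1 / 2 : ℝ) ^ d
        * (2 * Real.pi * (Real.cosh (Real.sqrt m2) - 1) / Real.sqrt (d * δ ^ 2 + m2) ^ 3 * Real.exp (-(Real.sqrt (d * δ ^ 2 + m2) * |(t : ℝ)|)))))
      ≤ kingS2Inf m2 (Pi.single ν t) := by
  rw [kingS2Inf_single_eq hm ν ht]
  refine mul_le_mul_of_nonneg_left ?_ (by positivity)
  set W : (Fin d → ℝ) → ℝ := fun q => (∏ j, Real.sinc (q j / 2) ^ 2) * (2 * Real.pi * (Real.cosh (Real.sqrt ((∑ j, q j ^ 2) + m2)) - 1)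
      / Real.sqrt ((∑ j, q j ^ 2) + m2) ^ 3 * Real.exp (-(Real.sqrt ((∑ j, q j ^ 2) + m2) * |(t : ℝ)|))) with hW
  have hWnn : 0 ≤ W := fun q => axisWeight_nonneg m2 (t : ℝ) q
  have hWint : Integrable W := integrable_axisWeight hm ht
  set C : Set (Fin d → ℝ) := Icc (fun _ => -δ) (fun _ => δ) with hC
  have hCvol : volume.real C = (2 * δ) ^ d := by
    rw [measureReal_def, hC, Real.volume_Icc_pi_toReal (fun _ => by linarith)]
    simp only [sub_neg_eq_add, Finset.prod_const, Finset.card_univ, Fintype.card_fin]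
    ring
  have h1 : volume.real C • ((1 / 2 : ℝ) ^ d * (2 * Real.pi * (Real.cosh (Real.sqrt m2) - 1) / Real.sqrt (d * δ ^ 2 + m2) ^ 3
      * Real.exp (-(Real.sqrt (d * δ ^ 2 + m2) * |(t : ℝ)|)))) ≤ ∫ q in C, W q :=
    setIntegral_ge_of_const_le measurableSet_Icc (isCompact_Icc.measure_lt_top).ne (fun q hq => axisWeight_ge_on_cube hm hδ hδ1 (t : ℝ) hq) hWint.integrableOn
  have h2 : ∫ q in C, W q ≤ ∫ q, W q := setIntegral_le_integral hWint (Eventually.of_forall hWnn)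
  rw [hCvol, smul_eq_mul] at h1
  exact h1.trans h2

/-! ## §4 The exact correlation length -/

/-- `t • e_ν = Pi.single ν t`. [folklore] -/
theorem zsmul_single_one (ν : Fin (d + 1)) (t : ℤ) : (t • (Pi.single ν (1 : ℤ) : Fin (d + 1) → ℤ)) = Pi.single ν t := by
  ext μ
  by_cases h : μ = ν
  · subst h; simp
  · simp [Pi.single_eq_of_ne h]

/-- `K^{1∕t} → 1` as `t → ∞` (`K > 0`; private plumbing). [folklore] -/
private theorem tendsto_const_rpow_inv' {K : ℝ} (hK : 0 < K) : Tendsto (fun t : ℕ => K ^ ((t : ℝ)⁻¹)) atTop (𝓝 1) := by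
  have h : (fun t : ℕ => K ^ ((t : ℝ)⁻¹)) = fun t : ℕ => Real.exp (Real.log K / (t : ℝ)) := by
    funext t
    rw [Real.rpow_def_of_pos hK, div_eq_mul_inv]
  rw [h, ← Real.exp_zero]
  exact (Real.continuous_exp.tendsto 0).comp (tendsto_const_div_atTop_nhds_zero_nat (Real.log K))

/-- ★★ For every `0 < δ ≤ 1`: `liminf_t |S₂^{ℝ}(te_ν)|^{1∕t} ≥ e^{−√(dδ²+m²)}`. [cite: King1986, Thm 3.3 (3.6) p.655] -/
theorem liminf_rpow_abs_kingS2Inf_axis_ge {m2 δ : ℝ} (hm : 0 < m2) (hδ : 0 < δ) (hδ1 : δ ≤ 1) (ν : Fin (d + 1)) :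
    Real.exp (-Real.sqrt (d * δ ^ 2 + m2))
      ≤ liminf (fun t : ℕ => |kingS2Inf m2 ((t : ℤ) • (Pi.single ν (1 : ℤ) : Fin (d + 1) → ℤ))| ^ ((t : ℝ)⁻¹)) atTop := by
  set Mδ := Real.sqrt (d * δ ^ 2 + m2) with hMδdef
  set K : ℝ := ((2 * Real.pi) ^ (d + 1))⁻¹ * ((2 * δ) ^ d * ((1 / 2 : ℝ) ^ d * (2 * Real.pi * (Real.cosh (Real.sqrt m2) - 1) / Mδ ^ 3))) with hKdef
  have hm' : 0 < Real.sqrt m2 := Real.sqrt_pos.mpr hm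
  have hc0 : 0 < Real.cosh (Real.sqrt m2) - 1 := by linarith [Real.one_lt_cosh.mpr hm'.ne']
  have hMδ0 : 0 < Mδ := Real.sqrt_pos.mpr (by positivity)
  have hK : 0 < K := by positivity
  -- the lower bound `K e^{−M_δ t} ≤ |S₂(te_ν)|` for `t ≥ 1`, in root form
  have hlow : ∀ᶠ t : ℕ in atTop, K ^ ((t : ℝ)⁻¹) * Real.exp (-Mδ)
      ≤ |kingS2Inf m2 ((t : ℤ) • (Pi.single ν (1 : ℤ) : Fin (d + 1) → ℤ))| ^ ((t : ℝ)⁻¹) := by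
    filter_upwards [eventually_ge_atTop 1] with t ht
    have ht0 : (0 : ℝ) < t := by exact_mod_cast ht
    have ht' : 1 ≤ |((t : ℤ) : ℝ)| := by
      rw [Int.cast_natCast, abs_of_nonneg ht0.le]
      exact_mod_cast ht
    have h := kingS2Inf_single_ge hm hδ hδ1 ν ht'
    rw [Int.cast_natCast, abs_of_nonneg ht0.le] at h
    have hpos : 0 ≤ K * Real.exp (-(Mδ * t)) := by positivity
    have hle : K * Real.exp (-(Mδ * t)) ≤ |kingS2Inf m2 ((t : ℤ) • (Pi.single ν (1 : ℤ) : Fin (d + 1) → ℤ))| := by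
      rw [zsmul_single_one]
      refine le_trans (le_of_eq ?_) (h.trans (le_abs_self _))
      rw [hKdef]
      ring
    have hr := Real.rpow_le_rpow hpos hle (inv_nonneg.mpr ht0.le)
    refine le_trans (le_of_eq ?_) hr
    rw [Real.mul_rpow hK.le (Real.exp_pos _).le, ← Real.exp_mul]
    congr 2
    field_simp
  have hg : Tendsto (fun t : ℕ => K ^ ((t : ℝ)⁻¹) * Real.exp (-Mδ)) atTop (𝓝 (Real.exp (-Mδ))) := by
    have h := (tendsto_const_rpow_inv' hK).mul_const (Real.exp (-Mδ))
    rwa [one_mul] at h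
  rw [← hg.liminf_eq]
  refine liminf_le_liminf hlow hg.isBoundedUnder_ge ?_
  -- `|S₂|^{1/t} ≤ max 1 m⁻²`: cobounded
  refine isCoboundedUnder_ge_of_eventually_le atTop (x := max 1 m2⁻¹) ?_
  filter_upwards [eventually_ge_atTop 1] with t ht
  have ht0 : (0 : ℝ) < t := by exact_mod_cast ht
  have hb := abs_kingS2Inf_le hm ((t : ℤ) • (Pi.single ν (1 : ℤ) : Fin (d + 1) → ℤ))
  have h1 : |kingS2Inf m2 ((t : ℤ) • (Pi.single ν (1 : ℤ) : Fin (d + 1) → ℤ))| ^ ((t : ℝ)⁻¹) ≤ (max 1 m2⁻¹) ^ ((t : ℝ)⁻¹) :=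
    Real.rpow_le_rpow (abs_nonneg _) (hb.trans (le_max_right _ _)) (inv_nonneg.mpr ht0.le)
  refine h1.trans ?_
  have hmax : 1 ≤ max 1 m2⁻¹ := le_max_left _ _
  calc (max 1 m2⁻¹) ^ ((t : ℝ)⁻¹) ≤ (max 1 m2⁻¹) ^ (1 : ℝ) :=
        Real.rpow_le_rpow_of_exponent_le hmax (inv_le_one_of_one_le₀ (by exact_mod_cast ht))
    _ = max 1 m2⁻¹ := Real.rpow_one _

/-- ★★ `liminf_t |S₂^{ℝ}(te_ν)|^{1∕t} ≥ e^{−√m²}` (let `δ → 0⁺`). [cite: King1986, Thm 3.3 (3.6) p.655] -/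
theorem le_liminf_rpow_abs_kingS2Inf_axis {m2 : ℝ} (hm : 0 < m2) (ν : Fin (d + 1)) :
    Real.exp (-Real.sqrt m2) ≤ liminf (fun t : ℕ => |kingS2Inf m2 ((t : ℤ) • (Pi.single ν (1 : ℤ) : Fin (d + 1) → ℤ))| ^ ((t : ℝ)⁻¹)) atTop := by
  -- along `δ_n = 1∕(n+1)`
  have hδ : Tendsto (fun n : ℕ => (1 : ℝ) / ((n : ℝ) + 1)) atTop (𝓝 0) := tendsto_one_div_add_atTop_nhds_zero_nat
  have hcont : Continuous fun δ : ℝ => Real.exp (-Real.sqrt (d * δ ^ 2 + m2)) := by fun_prop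
  have hlim : Tendsto (fun n : ℕ => Real.exp (-Real.sqrt (d * ((1 : ℝ) / ((n : ℝ) + 1)) ^ 2 + m2))) atTop (𝓝 (Real.exp (-Real.sqrt m2))) := by
    have h := (hcont.tendsto 0).comp hδ
    simp only [Function.comp_def, ne_eq, OfNat.ofNat_ne_zero, not_false_eq_true, zero_pow, mul_zero, zero_add] at h
    exact h
  refine le_of_tendsto hlim (Eventually.of_forall fun n => ?_)
  have hpos : (0 : ℝ) < 1 / ((n : ℝ) + 1) := by positivity
  have hle1 : (1 : ℝ) / ((n : ℝ) + 1) ≤ 1 := by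
    rw [div_le_one (by positivity)]
    linarith [(Nat.cast_nonneg n : (0 : ℝ) ≤ n)]
  exact liminf_rpow_abs_kingS2Inf_axis_ge hm hpos hle1 ν

/-- ★★★ **THE CORRELATION LENGTH OF KING'S FREE BLOCK FIELD IS EXACTLY `1∕m`**: for `m² > 0` and every lattice direction `ν`,
`lim_{t→∞} |S₂^{ℝ}(te_ν)|^{1∕t} = e^{−√m²}` — part Ϸ-e's `limsup ≤ e^{−m}` (Paley–Wiener) and this file's `liminf ≥ e^{−m}` (the Laplace representation with a
positive weight near `p_⊥ = 0`); the limit exists and the exponential decay rate along the axes is the mass, neither more nor less. [cite: King1986, Thm 3.3 (3.6) p.655,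
Thm 2.1 (2.22) p.654] -/
theorem tendsto_rpow_abs_kingS2Inf_axis {m2 : ℝ} (hm : 0 < m2) (ν : Fin (d + 1)) :
    Tendsto (fun t : ℕ => |kingS2Inf m2 ((t : ℤ) • (Pi.single ν (1 : ℤ) : Fin (d + 1) → ℤ))| ^ ((t : ℝ)⁻¹)) atTop (𝓝 (Real.exp (-Real.sqrt m2))) := by
  have hsup : limsup (fun t : ℕ => |kingS2Inf m2 ((t : ℤ) • (Pi.single ν (1 : ℤ) : Fin (d + 1) → ℤ))| ^ ((t : ℝ)⁻¹)) atTop ≤ Real.exp (-Real.sqrt m2) := by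
    have h := limsup_rpow_abs_kingS2Inf_ray_le hm (0 : Fin (d + 1) → ℤ) ν
    simp only [zero_add] at h
    exact h
  refine tendsto_of_le_liminf_of_limsup_le (le_liminf_rpow_abs_kingS2Inf_axis hm ν) hsup ?_ ?_
  · refine isBoundedUnder_of_eventually_le (f := atTop) (a := max 1 m2⁻¹) ?_
    filter_upwards [eventually_ge_atTop 1] with t ht
    have ht0 : (0 : ℝ) < t := by exact_mod_cast ht
    have hb := abs_kingS2Inf_le hm ((t : ℤ) • (Pi.single ν (1 : ℤ) : Fin (d + 1) → ℤ))
    have h1 : |kingS2Inf m2 ((t : ℤ) • (Pi.single ν (1 : ℤ) : Fin (d + 1) → ℤ))| ^ ((t : ℝ)⁻¹) ≤ (max 1 m2⁻¹) ^ ((t : ℝ)⁻¹) :=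
      Real.rpow_le_rpow (abs_nonneg _) (hb.trans (le_max_right _ _)) (inv_nonneg.mpr ht0.le)
    refine h1.trans ?_
    calc (max 1 m2⁻¹) ^ ((t : ℝ)⁻¹) ≤ (max 1 m2⁻¹) ^ (1 : ℝ) :=
          Real.rpow_le_rpow_of_exponent_le (le_max_left _ _) (inv_le_one_of_one_le₀ (by exact_mod_cast ht))
      _ = max 1 m2⁻¹ := Real.rpow_one _
  · exact isBoundedUnder_of_eventually_ge (f := atTop) (a := 0) (Eventually.of_forall fun t => Real.rpow_nonneg (abs_nonneg _) _)

end Summit.QuantumFields.YangMills.BalabanUVNodes.N15KingModelRung.OptimalDecay
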